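import Summits.BirchSwinnertonDyer.Rank1Residual.Additive.GordThreeCycLowerCore
import Summits.BirchSwinnertonDyer.Rank1Residual.Additive.CycLeadingTermDvdIff
import Summits.BirchSwinnertonDyer.Rank1Residual.Additive.GordRankZeroChiBranch
import Summits.BirchSwinnertonDyer.Rank1Residual.AdditivePotMult.TamagawaAtP
import Summits.BirchSwinnertonDyer.Rank1Residual.AdditivePotMult.RankZeroChiBranchThreeFacts
import Literature.NumberTheory.EllipticCurves.ZywinaCMImageProofs
import HarnessLib

/-!
# U3 / ROUTE-IW, companion file: the REDUCIBLE-image rows (class N10 ∩ X3 at `3`) and the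
# image dichotomy — `BSD(E,3)` on the potentially ORDINARY additive locus at `3`, rank `0`, is
# EQUIVALENT to the ONE `T = 0` Eisenstein binder for every mod-`3` image except irreducible-non-surjective
# (cell `bsd-uniform`, seat u3-p1; DRAFT pending `u3/ROUTE-IW.md`; sibling of `IwasawaDescentAtThree`)

HONEST FRAMING (cell `bsd-uniform`, run/shared/lean/pub/bsd-uniform/, verbatim in every file): the
goal of the cell is a CONDUCTOR-FREE BSD formula in analytic rank `≤ 1` via UNIFORM CLASS THEOREMS
whose hypotheses are class predicates and PRINTED theorems, replacing per-curve certificates. THIS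
FILE proves NO unconditional uniform theorem: every conclusion carries the OPEN binder
`Additive.CycLowerLeadingTermAt W 3` (A0 — the `T = 0`, Néron-period, integral LOWER divisibility of
Delbourgo's Main Conjecture at `3`, Compositio 113 (1998) p. 151; NOT in print). What IS proved:
on the rows with REDUCIBLE `E[3]` (class X3: a rational `3`-isogeny) of the potentially-ordinary
additive locus at `3`, rank `0` — (M)@3 (`ord₃ j < 0`) and (G-ord)@3 off its CM and anomalous rows —
Miller's `BSD(E,3)` is EQUIVALENT to A0, the UPPER half being Wuthrich 2014 Thm. 16 read on the
`ω`-component at `3` (PUBLISHED, no image hypothesis; `hW16`); and, joining the sibling file's surjective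
rows, the IMAGE DICHOTOMY: for every mod-`3` image except "irreducible but not surjective" (census
pocket O8), `BSD(E,3) ⟺ A0` on the locus. RESIDUE (HOME/RESIDUE.md §U3): O8 rows (Kato's (12.5.2)
fails; RESIDUE R3-2), anomalous (G)-rows (slack 2, R3-IW-2), CM (G)-rows with reducible `E[3]`
(Delbourgo 2002 excludes CM; WHY-NOT-3 §4 last row), potentially supersingular rows (R3-IW-4),
analytic rank `1` (R3-3). No summit claim; nothing booked; no density number moves (reducible `E[p]`
is height-density `0`: ledger-only rows).

WHY THIS IS NOVEL (one sentence): the tree has the X3(M)@3 and X3(G-ord)@3 closures from the LOWER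
half as separate end-states; this file joins them to the surjective rows into ONE image-dichotomy
statement on the potentially-ordinary additive locus at `3` and proves it an `iff` against the single
binder A0, so that the U3 residue at `3` on that locus is, image by image, EXACTLY {O8, anomalous,
CM-reducible} and nothing hidden.

Sources (explicit named-fact binders, all typed AT `p = 3`): Delbourgo 1998 Prop. 4 / §2.2 Lemma (ii)
(`Delbourgo1998.prop4_rankZero_pow_dvd_constantCoeff`, `…_constantCoeff_eq_unit_mul_of_potMult`;
"p an odd rational prime", p. 123); Delbourgo 2002 Theorem (A)+(B) at `3` (`Delbourgo2002.mainTheorem_three`;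
Hypothesis second bullet p. 39); C. Wuthrich, Doc. Math. 19 (2014) Thm. 16 (p. 397)
(`Wuthrich2014.thm16_minusEigenCharIdeal_dvd_cyclotomicThree`; reducible `E[p]`, `ω`-component at `3`);
Kato Thm. 17.4 (3) readings (`Wuthrich2014.kato_minusEigenCharIdeal_dvd_cyclotomicThree_of_surjective`,
`Kato2004.charIdeal_dvd_padicLFunctionBranch_component_of_surjective`) for the surjective branch;
GZK; modularity; Zywina 2015 Prop. 1.14/1.16 (THEOREM `WeierstrassCurve.not_hasSurjectiveModNGaloisRep_of_hasCM`);
Miller 2011 Def. 1.1. Literature sheet: `u3/WHY-NOT-3.md` §3–§4 (u3-lit). Theorems only (no `def`,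
no `sorry`); self-contained (does not import the sibling draft).
-/

noncomputable section

open scoped Classical NumberField

open WeierstrassCurve NumberField IsDedekindDomain Rat.HeightOneSpectrum
  Literature.NumberTheory.EllipticCurves
  Literature.NumberTheory.EllipticCurves.ModularForms
  Literature.NumberTheory.EllipticCurves.Rank1Residual
  Literature.NumberTheory.EllipticCurves.Rank1Residual.Typed
  Summit.BirchSwinnertonDyer.Rank1Residual
  Summit.BirchSwinnertonDyer.Rank1Residual.Additive

namespace Summit.BirchSwinnertonDyer.Uniform.U3

variable {W : WeierstrassCurve ℚ} [W.IsElliptic] [W.IsGloballyMinimal]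

/-! ### §1 Reducible `E[3]` (class X3), potentially ordinary at `3`, rank `0`: `BSD(E,3) ⟺ A0` -/

/-- **X3 rows: `BSD(E,3)` from the ONE binder.** For `E/ℚ` globally minimal of analytic rank `0`,
additive at `3`, `E[3]` REDUCIBLE (`Red W 3`), potentially multiplicative (`ord₃ j < 0`) or
(G)-ordinary, off the CM and anomalous rows of the (G)-part: A0 = `CycLowerLeadingTermAt W 3` gives
Miller's `BSD(E,3)`. LOWER: (M) Delbourgo 1998 Prop. 4 exact (`hDelX`), (G) Delbourgo 2002 (A)+(B) at
`3` (`hDel3`); UPPER: Wuthrich 2014 Thm. 16 on the `ω`-component (`hW16`, no image hypothesis) +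
Delbourgo 1998 Prop. 4 (`hDel`); GZK, modularity (`hmod`, `hmodD`).
[cite: Wuthrich2014, Thm. 16 (p. 397)] [cite: Delbourgo1998, Prop. 4 (p. 144), §2.2 Lemma (ii) (p. 139), Main Conjecture (p. 151)]
[cite: Delbourgo2002, Theorem (A), (B) (p. 40)] [cite: Miller2011LMS, §1 and Def. 1.1] -/
theorem bsdp_three_rankZero_of_red_of_cycLowerLeadingTerm [Fact (Nat.Prime 3)]
    (hDel : Delbourgo1998.prop4_rankZero_pow_dvd_constantCoeff)
    (hDelX : Delbourgo1998.prop4_rankZero_constantCoeff_eq_unit_mul_of_potMult)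
    (hDel3 : Delbourgo2002.mainTheorem_three)
    (hW16 : Wuthrich2014.thm16_minusEigenCharIdeal_dvd_cyclotomicThree)
    (hGZK : rank_eq_analyticRank_of_analyticRank_le_one) (hmod : hasEntireLFunction_rat)
    (hmodD : nonempty_modularParametrizationData)
    (hred : Red W 3) (hadd : Addv W 3) (hord : Additive.PotMult W 3 ∨ TypeGOrd W 3)
    (hr : W.analyticRank = 0) (hcm : TypeGOrd W 3 → ¬ W.HasCM)
    (hna : TypeGOrd W 3 → Delbourgo2002.ReductionNonAnomalous W 3)
    (hMC : CycLowerLeadingTermAt W 3) : BSDp W 3 := by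
  rcases hord with hM | hG
  · exact AdditivePotMult.ClassX3M.bsdp_three_rankZero_of_lower hDel hGZK hmod hmodD hW16
      ⟨⟨hred, hadd⟩, ⟨hadd, hM⟩, by decide⟩ hr
      (missingLowerBoundAt_rankZero_of_potMult_of_cycLeadingTermDvd W 3 hDelX hGZK hmod (by decide)
        hadd hM hr ((cycLeadingTermDvdAt_iff_cycLowerLeadingTermAt W 3).mpr hMC))
  · exact ClassX3Gord.bsdp_three_rankZero_of_cycLower_of_nonAnomalous hDel3 hW16 hDel hGZK hmod hmodD
      ⟨⟨hred, hadd⟩, hG⟩ (hcm hG) hr (hna hG) hMC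

/-- **Converse on the whole potentially-ordinary additive locus at `3`, rank `0` (any image):
`BSD(E,3)` gives back A0** — `BSD(E,3)` ⟹ the lower half in Miller's currency ⟹ (Delbourgo 1998
Prop. 4 `hDel`, GZK, modularity, `3 ∤ c₃(E)` automatic on the locus) the `T = 0` divisibility.
[cite: Delbourgo1998, Prop. 4 (p. 144), Main Conjecture (p. 151)] [cite: Miller2011LMS, §1 and Def. 1.1] -/
theorem cycLowerLeadingTerm_of_bsdp_three_rankZero [hp : Fact (Nat.Prime 3)]
    (hDel : Delbourgo1998.prop4_rankZero_pow_dvd_constantCoeff)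
    (hGZK : rank_eq_analyticRank_of_analyticRank_le_one) (hmod : hasEntireLFunction_rat)
    (hadd : Addv W 3) (hord : Additive.PotMult W 3 ∨ TypeGOrd W 3) (hr : W.analyticRank = 0)
    (hbsd : BSDp W 3) : CycLowerLeadingTermAt W 3 := by
  haveI : Finite W.sha := (hGZK W (hr.le.trans zero_le_one)).2
  have htam : ¬ 3 ∣ W.tamagawaNumberAt ((primesEquiv (R := 𝓞 ℚ)).symm ⟨3, hp.out⟩) := by
    rcases hord with hM | hG
    · exact AdditivePotMult.PotMult.not_dvd_tamagawaNumberAt (W := W) (p := 3) ⟨hadd, hM⟩ (by decide)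
    · exact TypeGOrd.not_dvd_tamagawaNumberAt_of_semistabilityIndex_eq_two W 3 (by decide) hG hadd
        (semistabilityIndex_eq_two_of_typeG_three W hG.typeG hadd)
  exact (cycLeadingTermDvdAt_iff_cycLowerLeadingTermAt W 3).mp
    (cycLeadingTermDvdAt_of_missingLowerBoundAt W 3 hDel hGZK hmod (by decide) hadd hord.symm hr htam
      (lower_and_upper_of_missingPPartAt W 3 (missingPPartAt_of_bsdp W 3 hbsd)).1)

/-- **X3 rows, the `iff`**: on the reducible-image rows of the potentially-ordinary additive locus at
`3`, rank `0`, off CM / anomalous (G)-rows, `BSD(E,3) ⟺ A0`. [cite: Wuthrich2014, Thm. 16 (p. 397)]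
[cite: Delbourgo1998, Prop. 4 (p. 144), Main Conjecture (p. 151)] [cite: Delbourgo2002, Theorem (A), (B) (p. 40)]
[cite: Miller2011LMS, §1 and Def. 1.1] -/
theorem bsdp_three_iff_cycLowerLeadingTerm_rankZero_of_red [Fact (Nat.Prime 3)]
    (hDel : Delbourgo1998.prop4_rankZero_pow_dvd_constantCoeff)
    (hDelX : Delbourgo1998.prop4_rankZero_constantCoeff_eq_unit_mul_of_potMult)
    (hDel3 : Delbourgo2002.mainTheorem_three)
    (hW16 : Wuthrich2014.thm16_minusEigenCharIdeal_dvd_cyclotomicThree)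
    (hGZK : rank_eq_analyticRank_of_analyticRank_le_one) (hmod : hasEntireLFunction_rat)
    (hmodD : nonempty_modularParametrizationData)
    (hred : Red W 3) (hadd : Addv W 3) (hord : Additive.PotMult W 3 ∨ TypeGOrd W 3)
    (hr : W.analyticRank = 0) (hcm : TypeGOrd W 3 → ¬ W.HasCM)
    (hna : TypeGOrd W 3 → Delbourgo2002.ReductionNonAnomalous W 3) :
    BSDp W 3 ↔ CycLowerLeadingTermAt W 3 :=
  ⟨cycLowerLeadingTerm_of_bsdp_three_rankZero hDel hGZK hmod hadd hord hr,
    bsdp_three_rankZero_of_red_of_cycLowerLeadingTerm hDel hDelX hDel3 hW16 hGZK hmod hmodD hred hadd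
      hord hr hcm hna⟩

/-! ### §2 The image dichotomy at `3`: reducible OR surjective (everything but census pocket O8) -/

/-- **Image dichotomy, rank `0`, potentially ordinary additive at `3`: `BSD(E,3) ⟺ A0` for every
mod-`3` image except irreducible-non-surjective.** If `E[3]` is reducible (X3) OR `ρ̄_{E,3}` is
surjective (X4 ∧ surj — then `¬CM` is a THEOREM, Zywina), and `E` is additive at `3`, potentially
multiplicative or (G)-ordinary, of analytic rank `0`, off the CM (relevant only for X3) and anomalous
rows of the (G)-part, then Miller's `BSD(E,3)` holds iff the `T = 0` Eisenstein divisibility A0 does.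
UPPER half: Wuthrich Thm. 16 (`hW16`) on X3, Kato Thm. 17.4 (3) readings (`hKato`, `hK`) on surj;
LOWER / converse: Delbourgo 1998/2002 (`hDel`, `hDelX`, `hDel3`); GZK; modularity. Outside: O8
(irreducible, not surjective: no printed upper half at an additive `3`).
[cite: Wuthrich2014, Thm. 16 (p. 397)] [cite: Kato2004Asterisque, Thm. 17.4 (3) (p. 273)]
[cite: Delbourgo1998, Prop. 4 (p. 144), Main Conjecture (p. 151)] [cite: Delbourgo2002, Theorem (A), (B) (p. 40)]
[cite: Zywina2015, Prop. 1.14 and Prop. 1.16 (§1.9)] [cite: Miller2011LMS, §1 and Def. 1.1] -/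
theorem bsdp_three_iff_cycLowerLeadingTerm_rankZero_of_red_or_surj [Fact (Nat.Prime 3)]
    (hDel : Delbourgo1998.prop4_rankZero_pow_dvd_constantCoeff)
    (hDelX : Delbourgo1998.prop4_rankZero_constantCoeff_eq_unit_mul_of_potMult)
    (hDel3 : Delbourgo2002.mainTheorem_three)
    (hW16 : Wuthrich2014.thm16_minusEigenCharIdeal_dvd_cyclotomicThree)
    (hKato : Wuthrich2014.kato_minusEigenCharIdeal_dvd_cyclotomicThree_of_surjective)
    (hK : Kato2004.charIdeal_dvd_padicLFunctionBranch_component_of_surjective)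
    (hGZK : rank_eq_analyticRank_of_analyticRank_le_one) (hmod : hasEntireLFunction_rat)
    (hmodD : nonempty_modularParametrizationData)
    (himg : Red W 3 ∨ Surj W 3) (hadd : Addv W 3) (hord : Additive.PotMult W 3 ∨ TypeGOrd W 3)
    (hr : W.analyticRank = 0) (hcm : Red W 3 → TypeGOrd W 3 → ¬ W.HasCM)
    (hna : TypeGOrd W 3 → Delbourgo2002.ReductionNonAnomalous W 3) :
    BSDp W 3 ↔ CycLowerLeadingTermAt W 3 := by
  refine ⟨cycLowerLeadingTerm_of_bsdp_three_rankZero hDel hGZK hmod hadd hord hr, fun hMC ↦ ?_⟩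
  rcases himg with hred | hsurj
  · exact bsdp_three_rankZero_of_red_of_cycLowerLeadingTerm hDel hDelX hDel3 hW16 hGZK hmod hmodD hred
      hadd hord hr (hcm hred) hna hMC
  · have hncm : ¬ W.HasCM := fun hCM ↦
      W.not_hasSurjectiveModNGaloisRep_of_hasCM hCM Nat.prime_three (by decide) hsurj
    have hX : ClassX4 W 3 :=
      ⟨by decide, hadd, hasIrreducibleModPGaloisRep_of_hasSurjectiveModNGaloisRep W 3 hsurj⟩
    rcases hord with hM | hG
    · exact AdditivePotMult.ClassX4M.bsdp_three_rankZero_of_surj_of_lower' hDel hGZK hmod hmodD hKato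
        ⟨hX, hadd, hM⟩ hr hsurj
        (missingLowerBoundAt_rankZero_of_potMult_of_cycLeadingTermDvd W 3 hDelX hGZK hmod (by decide)
          hadd hM hr ((cycLeadingTermDvdAt_iff_cycLowerLeadingTermAt W 3).mpr hMC))
    · exact ClassX4Gord.bsdp_three_rankZero_of_cycLower_of_nonAnomalous_of_surj hDel3 hK hDel hGZK hmod
        hmodD ⟨hX, hG⟩ hncm hr hsurj (hna hG) hMC

end Summit.BirchSwinnertonDyer.Uniform.U3

end
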